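/-
Copyright (c) 2026 the pub-hodgecm-mathlib formalisation cell (harness21).  Prover seat hodgecm-mathlib-F0P3-p02 (g16), 2026-09-01.  Road «S3-ram» seeding wave (LEAD F0P3a-plan (g12) T11-41∕T11-54∕T11-57;
owner F0P3a-p06 (g15)), row «(L)-ram» file L4: the `N ∩ K₃`-average of a `v`-level-one `K`-class piece through a level frame at a TAME-RAMIFIED place (the `hN` socket of ★ p846921).
-/
import Literature.NumberTheory.Automorphic.TorusTwoDeepLevelTwoStrataRamified       -- ★ FILE L3 (this seat): `apply_symm_torus_mul_levelTwo_values_of_ramified`; ⊇ ★ FILE L2 `integral_eq_of_levelTwo_strata_of_ramified`, ★ p846625 §3 regular twist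
import Literature.NumberTheory.Automorphic.TorusLevelDeepOrbitalIntegralSocket       -- ★ p846915 (F0P3a-p01 (g15)): `valued_symm_torus_sub_one_le` (`(ψ⁻¹t)_w ≡ 1 (ϖ_v)` for a level-deep `t`)
import Literature.NumberTheory.Automorphic.CMXiTorusCharSplitTorusDecay              -- ★ `exists_torusU_entry_eq` (the split-torus element `d(a, 1, a⁻¹)` for a `σ`-fixed unit `a`)
import Literature.NumberTheory.Rogawski1990.FinExplicitTransferFactorConjRight        -- ★ `isUnit_localRing_of_ne_zero_of_subsingleton`
import HarnessLib

/-!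
# The `N ∩ K₃`-average of a `v`-level-one `K`-class piece through a level frame at a TAME-RAMIFIED place
(Rogawski (1990) §4.9 pp. 54–56, §12.2 p. 173; Kottwitz (1986) §3; Jacobowitz (1962) §5)

Topic `NumberTheory/Automorphic`; namespace `Literature.NumberTheory.Automorphic.UnitaryGroup`.  KERNEL mathematics only: theorems, no definition, no named fact, no instance,
no notation, no `sorry`.  Cell `pub/hodgecm-mathlib`, crux H413 = `stmt-HodgeConjecture-24833`; road «S3-ram» seeding wave (LEAD F0P3a-plan (g12); owner F0P3a-p06 (g15)), row **«(L)-ram»,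
FILE L4** (seat F0P3-p02 (g16)).  CONSUMER: the socket **`hN`** of F0P3a-p01 (g15)'s ★ p846921 `finsum_delta_mul_classOrbitalIntegral_eq_of_levi_ramified_levelOne_of_delta_eq` — the
ramified LEVI clause (e3) of END's fold v6 `stub_levelOneRowsRam` :118 in :118 currency — which asks, for EVERY level frame `ψ` with integral matrix reading `(ψ x)_w = T x_w T⁻¹` and
EVERY Haar measure `μ_N` of `N`, for the scalar `X` with `∫_N g(ψ⁻¹ n) dμ_N = μ_N(N ∩ K₃)·X`.  HONEST LABEL: HC_CM is proved only modulo the 2 remaining named inputs (hLiu418 24832,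
h413 24833) until rung 0 closes; «S3-ram» is Literature seeding; this file discharges no named fact.

THE MATHEMATICS.  `v` non-split and TAMELY RAMIFIED in `L` (`e(w|v) ≠ 1`, `|2|_w = 1`, `q = N𝔭_v`), `ϖ ∈ L_w` with `|ϖ| = exp(−1)`; `g` a `K′`-class piece supported in `K′`, LEFT-INVARIANT
under the `v`-level-one congruence set `K(ϖ_v)` (END's `hg1` token `(ι_v ϖ_v)^1` VERBATIM), with the strata values `c₂` (boundary-regular, guarded by a `v`-deep class) and `c′ 0, c′ 1, c′ 2`
(the `𝔭`-layer) of ★ FILE L3.  The auxiliary split-torus element `t₁ = d(1 + ϖ_v, 1, (1 + ϖ_v)⁻¹) ∈ T` (★ `exists_torusU_entry_eq`; `ι_v ϖ_v` is `σ`-fixed) is REGULAR in the sense of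
★ FILE L3 (`d₀⁻¹d₁ − 1`, `d₀⁻¹d₂ − 1` are non-zero, hence units of `L_w = R`) and 2-DEEP in `w` (`|d_{i,w} − 1| ≤ |ϖ_v|_w = exp(−2)`, ★ `valued_toPlace_uniformizer_of_ramified`), so
`(ψ⁻¹ t₁)_w ≡ 1 (ϖ_v)` (★ p846915 `valued_symm_torus_sub_one_le`) and `g(ψ⁻¹(t₁ n)) = g(ψ⁻¹ t₁ · ψ⁻¹ n) = g(ψ⁻¹ n)`.  Hence the values of `n ↦ g(ψ⁻¹ n)` on the strata of `N ∩ K₃`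
are those of ★ FILE L3 `apply_symm_torus_mul_levelTwo_values_of_ramified` at `t₁`, and ★ FILE L2 `integral_eq_of_levelTwo_strata_of_ramified` gives
**`∫_N g(ψ⁻¹ n) dμ_N = μ_N(N ∩ K₃) · (c₂·(1 − q⁻¹) + q⁻¹·(c′ 2·(1 − q⁻¹) + c′ 1·q⁻¹(1 − q⁻¹) + c′ 0·q⁻²))`** (`integral_comp_symm_eq_of_levelOne_ramified`) — `hN` with that `X`.

## References
* [Rogawski1990] J. D. Rogawski, *Automorphic Representations of Unitary Groups in Three Variables*, Ann. of Math. Stud. 123 (1990), §1.10 p. 9; §4.9 pp. 54–56; §12.2 p. 173.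
* [Kottwitz1986] R. E. Kottwitz, *Base change for unit elements of Hecke algebras*, Compositio Math. 60 (1986), §3 (congruence filtration).
* [Jacobowitz1962] R. Jacobowitz, *Hermitian forms over local fields*, Amer. J. Math. 84 (1962), §5 (ramified case).
-/

set_option autoImplicit false

noncomputable section

open MeasureTheory Measure Set Filter Topology NumberField IsDedekindDomain Matrix ValuativeRel
open scoped ENNReal NNReal Matrix MatrixGroups ValuativeRel WithZero

namespace Literature.NumberTheory.Automorphic.UnitaryGroup

open Literature.NumberTheory.Rogawski1990 (IsRegularElt isUnit_localRing_of_ne_zero_of_subsingleton)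
open Literature.NumberTheory.Automorphic Literature.NumberTheory.Automorphic.IntegralReduction Literature.NumberTheory.GaloisRepresentations

variable (L : Type) [Field L] [NumberField L] [IsCMField L] {v : HeightOneSpectrum (𝓞 ↥(maximalRealSubfield L))}
  (w : PlacesOver L v) (hw : IsCMField.complexConj L • w.1 = w.1)

/-! ## §1 An auxiliary regular 2-deep split-torus element at a tame-ramified place -/

include hw in
/-- **`t₁ = d(1 + ϖ_v, 1, (1 + ϖ_v)⁻¹) ∈ T`** at a tame-ramified non-split place: a split-torus element with `d₀⁻¹d₁ − 1`, `d₀⁻¹d₂ − 1` units of `R = L_w` and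
`|d_{i,w} − 1|_w ≤ exp(−2)` (`|ι_v ϖ_v|_w = exp(−2)` ★ `valued_toPlace_uniformizer_of_ramified`). [cite: Rogawski1990, §1.10 p. 9; §4.9 p. 55] [cite: Jacobowitz1962, §5] -/
theorem exists_torusU_regular_twoDeep_of_ramified (he : v.asIdeal.ramificationIdx' w.1.asIdeal ≠ 1) (h2w : Valued.v (2 : w.1.adicCompletion L) = 1) :
    ∃ (t : ↥(torusU (conjLocal L (IsCMField.complexConj L) v) (cmLocalForm L 3 v))) (d : Fin 3 → (LocalRing L v)ˣ),
      glDiagonal 3 (LocalRing L v) d = ((t : ↥(unitaryGroupOfForm (conjLocal L (IsCMField.complexConj L) v) (cmLocalForm L 3 v))) : GL (Fin 3) (LocalRing L v)) ∧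
      IsUnit ((((d 0)⁻¹ * d 1 : (LocalRing L v)ˣ) : LocalRing L v) - 1) ∧ IsUnit ((((d 0)⁻¹ * d 2 : (LocalRing L v)ˣ) : LocalRing L v) - 1) ∧
      ∀ i : Fin 3, Valued.v ((((d i : (LocalRing L v)ˣ) : LocalRing L v) w) - 1) ≤ WithZero.exp (-2 : ℤ) := by
  have hcne := IsCMField.complexConj_ne_one L
  haveI : Algebra.IsQuadraticExtension ↥(maximalRealSubfield L) L := IsCMField.isQuadraticExtension L
  haveI hsub : Subsingleton (PlacesOver L v) := PlacesOver.subsingleton_of_smul_eq (IsCMField.complexConj L) hcne w hw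
  set P : LocalRing L v := (((isUnit_toLocalRing_uniformizer L v).unit : (LocalRing L v)ˣ) : LocalRing L v) with hPdef
  have hPw : Valued.v (P w) = WithZero.exp (-2 : ℤ) := valued_toLocalRing_uniformizer_apply_of_ramified L v w hw he
  have hPσ : conjLocal L (IsCMField.complexConj L) v P = P := conjLocal_toLocalRing_uniformizer L v
  have he2 : WithZero.exp (-2 : ℤ) < (1 : ℤᵐ⁰) := by rw [← WithZero.exp_zero, WithZero.exp_lt_exp]; norm_num
  have hPw1 : Valued.v (P w) < 1 := by rw [hPw]; exact he2
  have hP0 : P w ≠ 0 := fun h => by rw [h, map_zero] at hPw; exact WithZero.zero_ne_coe hPw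
  -- `a = 1 + P` is a `σ`-fixed unit with `|a_w − 1| = exp(−2)` and `|a_w| = 1`
  have haw : Valued.v ((1 + P) w) = 1 := by
    rw [Pi.add_apply, Pi.one_apply, Valuation.map_add_eq_of_lt_left _ (by rw [Valuation.map_one]; exact hPw1), Valuation.map_one]
  have ha0 : (1 + P : LocalRing L v) ≠ 0 := fun h => by
    have h' := congrFun h w
    rw [Pi.zero_apply] at h'
    rw [h', map_zero] at haw; exact zero_ne_one haw
  have haU : IsUnit (1 + P : LocalRing L v) := isUnit_localRing_of_ne_zero_of_subsingleton L v hsub ha0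
  set a : (LocalRing L v)ˣ := haU.unit with hadef
  have hav : (a : LocalRing L v) = 1 + P := haU.unit_spec
  have haσ : conjLocal L (IsCMField.complexConj L) v (a : LocalRing L v) = a := by rw [hav, map_add, map_one, hPσ]
  obtain ⟨t, ht0, ht1⟩ := exists_torusU_entry_eq (conjLocal L (IsCMField.complexConj L) v) (cmLocalForm L 3 v) (cmLocalForm_eq_over L 3 v) a haσ
  obtain ⟨d, hd⟩ := t.2
  have hd0 : d 0 = a := by rw [← torusEntry_eq_of_glDiagonal_eq _ _ 0 t d hd, ht0]
  have hd1 : d 1 = 1 := by rw [← torusEntry_eq_of_glDiagonal_eq _ _ 1 t d hd, ht1]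
  obtain ⟨h20, -, -⟩ := HeisRing.torus_relations (conjLocal L (IsCMField.complexConj L) v) (cmLocalForm_eq_over L 3 v) t hd
  -- `d 2 = a⁻¹`: from `σ(d₂)·d₀ = 1` and `σ a = a`
  have hd2 : ((d 2 : (LocalRing L v)ˣ) : LocalRing L v) = ((a⁻¹ : (LocalRing L v)ˣ) : LocalRing L v) := by
    have hσσ := conjLocal_conjLocal_cm L v
    have h1 : conjLocal L (IsCMField.complexConj L) v ((d 2 : (LocalRing L v)ˣ) : LocalRing L v) = ((a⁻¹ : (LocalRing L v)ˣ) : LocalRing L v) := by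
      rw [hd0] at h20
      calc conjLocal L (IsCMField.complexConj L) v ((d 2 : (LocalRing L v)ˣ) : LocalRing L v)
          = conjLocal L (IsCMField.complexConj L) v ((d 2 : (LocalRing L v)ˣ) : LocalRing L v) * ((a : LocalRing L v) * ((a⁻¹ : (LocalRing L v)ˣ) : LocalRing L v)) := by
            rw [Units.mul_inv, mul_one]
        _ = ((a⁻¹ : (LocalRing L v)ˣ) : LocalRing L v) := by rw [← mul_assoc, h20, one_mul]
    have h2 := congrArg (conjLocal L (IsCMField.complexConj L) v) h1
    rw [hσσ] at h2
    rw [h2, HeisRing.map_units_inv_of_fixed (conjLocal L (IsCMField.complexConj L) v) a haσ]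
  have hainv : ((a⁻¹ : (LocalRing L v)ˣ) : LocalRing L v) * (1 + P) = 1 := by rw [← hav, Units.inv_mul]
  refine ⟨t, d, hd, ?_, ?_, fun i => ?_⟩
  · -- `d₀⁻¹d₁ − 1 = a⁻¹ − 1 ≠ 0`: otherwise `a⁻¹ = 1`, `1 + P = 1` at `w`
    refine isUnit_localRing_of_ne_zero_of_subsingleton L v hsub fun h0 => ?_
    have h0' : ((((d 0)⁻¹ * d 1 : (LocalRing L v)ˣ)) : LocalRing L v) = 1 := sub_eq_zero.1 h0
    rw [hd1, mul_one, hd0] at h0'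
    have h := congrFun hainv w
    rw [Pi.mul_apply, Pi.add_apply, Pi.one_apply, congrFun h0' w, Pi.one_apply, one_mul, add_eq_left] at h
    exact hP0 h
  · -- `d₀⁻¹d₂ − 1 = a⁻² − 1 ≠ 0`
    refine isUnit_localRing_of_ne_zero_of_subsingleton L v hsub fun h0 => ?_
    have h0' : (((d 0)⁻¹ * d 2 : (LocalRing L v)ˣ) : LocalRing L v) = 1 := sub_eq_zero.1 h0
    rw [Units.val_mul, hd2, hd0] at h0'
    -- multiply by `a²`: `1 = (1 + P)²`, i.e. `P(2 + P) = 0` at `w`, impossible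
    have hsq : (1 + P) * (1 + P) = (1 : LocalRing L v) := by
      calc (1 + P) * (1 + P) = (1 + P) * (1 + P) * ((((a⁻¹ : (LocalRing L v)ˣ) : LocalRing L v)) * ((a⁻¹ : (LocalRing L v)ˣ) : LocalRing L v)) := by rw [h0', mul_one]
        _ = ((1 + P) * ((a⁻¹ : (LocalRing L v)ˣ) : LocalRing L v)) * ((1 + P) * ((a⁻¹ : (LocalRing L v)ˣ) : LocalRing L v)) := by ring
        _ = 1 := by rw [mul_comm (1 + P), hainv, one_mul]
    have hw' := congrFun hsq w
    simp only [Pi.mul_apply, Pi.add_apply, Pi.one_apply] at hw'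
    have hP2 : P w * (2 + P w) = 0 := by linear_combination hw'
    rcases mul_eq_zero.1 hP2 with h | h
    · exact hP0 h
    · have h2v : Valued.v (2 + P w) = 1 := by
        rw [Valuation.map_add_eq_of_lt_left _ (by rw [h2w]; exact hPw1), h2w]
      rw [h, map_zero] at h2v; exact zero_ne_one h2v
  · fin_cases i
    · show Valued.v ((((d 0 : (LocalRing L v)ˣ) : LocalRing L v) w) - 1) ≤ WithZero.exp (-2 : ℤ)
      rw [hd0, hav, Pi.add_apply, Pi.one_apply, add_sub_cancel_left, hPw]
    · show Valued.v ((((d 1 : (LocalRing L v)ˣ) : LocalRing L v) w) - 1) ≤ WithZero.exp (-2 : ℤ)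
      rw [hd1, Units.val_one, Pi.one_apply, sub_self, map_zero]; exact zero_le
    · show Valued.v ((((d 2 : (LocalRing L v)ˣ) : LocalRing L v) w) - 1) ≤ WithZero.exp (-2 : ℤ)
      -- `a⁻¹ − 1 = −a⁻¹·P` and `|a⁻¹_w| = 1`
      have hinvw : Valued.v (((a⁻¹ : (LocalRing L v)ˣ) : LocalRing L v) w) = 1 := by
        have h := congrFun hainv w
        rw [Pi.mul_apply, Pi.one_apply] at h
        have hv := congrArg Valued.v h
        rw [map_mul, haw, mul_one, map_one] at hv
        exact hv
      have hrew : (((a⁻¹ : (LocalRing L v)ˣ) : LocalRing L v) w) - 1 = -((((a⁻¹ : (LocalRing L v)ˣ) : LocalRing L v) w) * P w) := by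
        have h := congrFun hainv w
        rw [Pi.mul_apply, Pi.add_apply, Pi.one_apply, mul_add, mul_one] at h
        linear_combination h
      rw [hd2, hrew, Valuation.map_neg, map_mul, hinvw, one_mul, hPw]

/-! ## §2 The `N ∩ K₃`-average of a `v`-level-one `K`-class piece through a level frame (the `hN` socket of ★ p846921) -/

set_option maxHeartbeats 1600000 in
-- instance-term unification on the CM local carriers (as in ★ FILE D ∕ ★ p846544 ∕ ★ FILE L3)
include hw in
/-- **THE `N ∩ K₃`-AVERAGE OF A `v`-LEVEL-ONE `K`-CLASS PIECE, TAME-RAMIFIED PLACE.**  `ψ` a level-preserving frame reading `(ψ x)_w = T x_w T⁻¹` (`T ∈ GL₃(𝒪_w)`), `μ_N` ANY Haar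
measure of `N`, `ϖ ∈ L_w` with `|ϖ| = exp(−1)`; `g` supported in `K′`, LEFT-INVARIANT under the `v`-level-one congruence set (`hg1`, END fold v6 :118 VERBATIM) with the strata
values `hc` (boundary-regular in a `v`-deep class ↦ `c₂`) and `hc′` (`𝔭`-layer ↦ `c′ 0, c′ 1, c′ 2`) of ★ FILE L3.  Then
**`∫_N g(ψ⁻¹ n) dμ_N = μ_N(N ∩ K₃) · (c₂·(1 − q⁻¹) + q⁻¹·(c′ 2·(1 − q⁻¹) + c′ 1·q⁻¹(1 − q⁻¹) + c′ 0·q⁻²))`**, `q = N𝔭_v` — the `hN` socket of ★ p846921 with that `X`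
(★ FILE L3 §4 at the auxiliary regular 2-deep `t₁` of §1, moved off by `hg1` through ★ `valued_symm_torus_sub_one_le`, then ★ FILE L2 `integral_eq_of_levelTwo_strata_of_ramified`).
[cite: Rogawski1990, §4.9 Prop. 4.9.1 pp. 54–56; §12.2 p. 173] [cite: Kottwitz1986, §3] [cite: Jacobowitz1962, §5] -/
theorem integral_comp_symm_eq_of_levelOne_ramified (H' : Matrix (Fin 3) (Fin 3) L)
    [MeasurableSpace ↥(unitaryGroupOfForm (conjLocal L (IsCMField.complexConj L) v) (cmLocalForm L 3 v))] [BorelSpace ↥(unitaryGroupOfForm (conjLocal L (IsCMField.complexConj L) v) (cmLocalForm L 3 v))]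
    (ψ : (cmDatum L 3 H').Local v ≃ₜ* ↥(unitaryGroupOfForm (conjLocal L (IsCMField.complexConj L) v) (cmLocalForm L 3 v)))
    (hψK : ∀ g : (cmDatum L 3 H').Local v, ψ g ∈ cmLocalIntegralLevel L 3 (Matrix.of fun i j : Fin 3 => if i.val + j.val + 1 = 3 then (1 : L) else 0) v ↔
      g ∈ cmLocalIntegralLevel L 3 H' v)
    (T : GL (Fin 3) (w.1.adicCompletion L)) (hT : T ∈ glInt 3 (w.1.adicCompletion L))
    (hψT : ∀ g : (cmDatum L 3 H').Local v, localGLPiEquiv L 3 v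
        (((ψ g : ↥(unitaryGroupOfForm (conjLocal L (IsCMField.complexConj L) v) (cmLocalForm L 3 v)))) : GL (Fin 3) (LocalRing L v)) w =
      T * localGLPiEquiv L 3 v (g.val : GL (Fin 3) (LocalRing L v)) w * T⁻¹)
    (he : v.asIdeal.ramificationIdx' w.1.asIdeal ≠ 1) {ϖ : w.1.adicCompletion L} (hϖ : Valued.v ϖ = WithZero.exp (-1 : ℤ)) (h2w : Valued.v (2 : w.1.adicCompletion L) = 1)
    [MeasurableSpace ↥(unipotentU (conjLocal L (IsCMField.complexConj L) v) (cmLocalForm L 3 v))] [BorelSpace ↥(unipotentU (conjLocal L (IsCMField.complexConj L) v) (cmLocalForm L 3 v))]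
    (μN : Measure ↥(unipotentU (conjLocal L (IsCMField.complexConj L) v) (cmLocalForm L 3 v))) [μN.IsHaarMeasure]
    (g : (cmDatum L 3 H').Local v → ℂ) (hgK : tsupport g ⊆ (cmLocalIntegralLevel L 3 H' v : Set ((cmDatum L 3 H').Local v)))
    (hg1 : ∀ u : (cmDatum L 3 H').Local v,
      (∀ a b, Valued.v (((toPlace v w (HeckeCharacter.uniformizer ↥(maximalRealSubfield L) v : v.adicCompletion ↥(maximalRealSubfield L))) ^ 1)⁻¹ *
        ((((localNonsplitEquiv (IsCMField.complexConj L) H' (IsCMField.complexConj_ne_one L) w hw (u) :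
            ↥(unitaryGroupOfForm (galAdicCompletionMap (L := L) (IsCMField.complexConj L) hw) (placeForm H' w.1))) : GL (Fin 3) (w.1.adicCompletion L)) :
              Matrix (Fin 3) (Fin 3) (w.1.adicCompletion L)) a b - (1 : Matrix (Fin 3) (Fin 3) (w.1.adicCompletion L)) a b)) ≤ 1) →
      ∀ x, g (u * x) = g x)
    (c₂ : ℂ) (c' : ℕ → ℂ) (hc : ∀ x : ((cmDatum L 3 H').Local v), (x ∈ cmLocalIntegralLevel L 3 H' v ∧ (redMat (((x).val : GL (Fin 3) (UnitaryGroup.LocalRing L v)).val.map (Pi.evalRingHom (fun w' : PlacesOver L v => w'.1.adicCompletion L) w)) - 1) ^ 3 = 0 ∧ (redMat (((x).val : GL (Fin 3) (UnitaryGroup.LocalRing L v)).val.map (Pi.evalRingHom (fun w' : PlacesOver L v => w'.1.adicCompletion L) w)) - 1).rank = 2 ∧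
        ∃ y : ((cmDatum L 3 H').Local v), (∀ a b, Valued.v (((toPlace v w (HeckeCharacter.uniformizer ↥(maximalRealSubfield L) v : v.adicCompletion ↥(maximalRealSubfield L))) ^ 1)⁻¹ *
        ((((localNonsplitEquiv (IsCMField.complexConj L) H' (IsCMField.complexConj_ne_one L) w hw (y * x * y⁻¹) :
            ↥(unitaryGroupOfForm (galAdicCompletionMap (L := L) (IsCMField.complexConj L) hw) (placeForm H' w.1))) : GL (Fin 3) (w.1.adicCompletion L)) :
              Matrix (Fin 3) (Fin 3) (w.1.adicCompletion L)) a b - (1 : Matrix (Fin 3) (Fin 3) (w.1.adicCompletion L)) a b)) ≤ 1)) → g x = c₂)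
    (hc' : ((∀ x : ((cmDatum L 3 H').Local v), (x ∈ cmLocalIntegralLevel L 3 H' v ∧ (∀ a b, Valued.v (ϖ⁻¹ * ((((x).val : GL (Fin 3) (UnitaryGroup.LocalRing L v)).val.map (Pi.evalRingHom (fun w' : PlacesOver L v => w'.1.adicCompletion L) w)) a b - (1 : Matrix (Fin 3) (Fin 3) (w.1.adicCompletion L)) a b)) ≤ 1) ∧
        (redMat (ϖ⁻¹ • ((((x).val : GL (Fin 3) (UnitaryGroup.LocalRing L v)).val.map (Pi.evalRingHom (fun w' : PlacesOver L v => w'.1.adicCompletion L) w)) - 1))) ^ 3 = 0 ∧ (redMat (ϖ⁻¹ • ((((x).val : GL (Fin 3) (UnitaryGroup.LocalRing L v)).val.map (Pi.evalRingHom (fun w' : PlacesOver L v => w'.1.adicCompletion L) w)) - 1))).rank = 0) → g x = c' 0) ∧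
      (∀ x : ((cmDatum L 3 H').Local v), (x ∈ cmLocalIntegralLevel L 3 H' v ∧ (∀ a b, Valued.v (ϖ⁻¹ * ((((x).val : GL (Fin 3) (UnitaryGroup.LocalRing L v)).val.map (Pi.evalRingHom (fun w' : PlacesOver L v => w'.1.adicCompletion L) w)) a b - (1 : Matrix (Fin 3) (Fin 3) (w.1.adicCompletion L)) a b)) ≤ 1) ∧
        (redMat (ϖ⁻¹ • ((((x).val : GL (Fin 3) (UnitaryGroup.LocalRing L v)).val.map (Pi.evalRingHom (fun w' : PlacesOver L v => w'.1.adicCompletion L) w)) - 1))) ^ 3 = 0 ∧ (redMat (ϖ⁻¹ • ((((x).val : GL (Fin 3) (UnitaryGroup.LocalRing L v)).val.map (Pi.evalRingHom (fun w' : PlacesOver L v => w'.1.adicCompletion L) w)) - 1))).rank = 1) → g x = c' 1) ∧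
      (∀ x : ((cmDatum L 3 H').Local v), (x ∈ cmLocalIntegralLevel L 3 H' v ∧ (∀ a b, Valued.v (ϖ⁻¹ * ((((x).val : GL (Fin 3) (UnitaryGroup.LocalRing L v)).val.map (Pi.evalRingHom (fun w' : PlacesOver L v => w'.1.adicCompletion L) w)) a b - (1 : Matrix (Fin 3) (Fin 3) (w.1.adicCompletion L)) a b)) ≤ 1) ∧
        (redMat (ϖ⁻¹ • ((((x).val : GL (Fin 3) (UnitaryGroup.LocalRing L v)).val.map (Pi.evalRingHom (fun w' : PlacesOver L v => w'.1.adicCompletion L) w)) - 1))) ^ 3 = 0 ∧ (redMat (ϖ⁻¹ • ((((x).val : GL (Fin 3) (UnitaryGroup.LocalRing L v)).val.map (Pi.evalRingHom (fun w' : PlacesOver L v => w'.1.adicCompletion L) w)) - 1))).rank = 2) → g x = c' 2))) :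
    ∫ n, g (ψ.symm (n : ↥(unitaryGroupOfForm (conjLocal L (IsCMField.complexConj L) v) (cmLocalForm L 3 v)))) ∂μN =
      (μN.real {n : ↥(unipotentU (conjLocal L (IsCMField.complexConj L) v) (cmLocalForm L 3 v)) | (n : ↥(unitaryGroupOfForm (conjLocal L (IsCMField.complexConj L) v) (cmLocalForm L 3 v))) ∈ cmLocalIntegralLevel L 3 (Matrix.of fun i j : Fin 3 => if i.val + j.val + 1 = 3 then (1 : L) else 0) v} : ℂ) *
        (c₂ * (1 - (Ideal.absNorm v.asIdeal : ℂ)⁻¹) +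
          (Ideal.absNorm v.asIdeal : ℂ)⁻¹ * (c' 2 * (1 - (Ideal.absNorm v.asIdeal : ℂ)⁻¹) + c' 1 * ((Ideal.absNorm v.asIdeal : ℂ)⁻¹ * (1 - (Ideal.absNorm v.asIdeal : ℂ)⁻¹)) +
            c' 0 * ((Ideal.absNorm v.asIdeal : ℂ) ^ 2)⁻¹)) := by
  obtain ⟨t, d, hd, ha', hb', ht2⟩ := exists_torusU_regular_twoDeep_of_ramified L w hw he h2w
  obtain ⟨hF₅, hF₃, hF₂, hF₁, hF₀⟩ := apply_symm_torus_mul_levelTwo_values_of_ramified L w hw H' ψ hψK T hT hψT he hϖ h2w t hd ha' hb' ht2 g hgK c₂ c' hc hc'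
  -- the auxiliary torus element is `v`-level deep, so `ψ⁻¹ t` lies in the `hg1` set and `g(ψ⁻¹(t n)) = g(ψ⁻¹ n)`
  have htd : ∀ i : Fin 3, Valued.v ((((d i : (LocalRing L v)ˣ) : LocalRing L v) w) - 1) ≤ Valued.v (toPlace v w (HeckeCharacter.uniformizer ↥(maximalRealSubfield L) v : v.adicCompletion ↥(maximalRealSubfield L))) := fun i => by
    rw [(valued_toPlace_uniformizer_of_ramified L (IsCMField.complexConj L) (IsCMField.complexConj_ne_one L) w hw he).1]; exact ht2 i
  have hshift : ∀ n : ↥(unipotentU (conjLocal L (IsCMField.complexConj L) v) (cmLocalForm L 3 v)), g (ψ.symm ((t : ↥(unitaryGroupOfForm (conjLocal L (IsCMField.complexConj L) v) (cmLocalForm L 3 v))) * (n : ↥(unitaryGroupOfForm (conjLocal L (IsCMField.complexConj L) v) (cmLocalForm L 3 v))))) = g (ψ.symm (n : ↥(unitaryGroupOfForm (conjLocal L (IsCMField.complexConj L) v) (cmLocalForm L 3 v)))) := fun n => by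
    rw [map_mul]
    exact hg1 _ (valued_symm_torus_sub_one_le L w hw H' ψ T hT hψT t hd htd) _
  exact integral_eq_of_levelTwo_strata_of_ramified L v w hw μN hϖ he h2w (c' 0) (c' 1) (c' 2) c₂ _
    (fun n hn hr => by rw [← hshift]; exact hF₅ n hn hr) (fun n hn h0 hs => by rw [← hshift]; exact hF₃ n hn h0 hs)
    (fun n hn h0 hs => by rw [← hshift]; exact hF₂ n hn h0 hs) (fun n hn h0 hs => by rw [← hshift]; exact hF₁ n hn h0 hs)
    (fun n hn => by rw [← hshift]; exact hF₀ n hn)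

end Literature.NumberTheory.Automorphic.UnitaryGroup

end
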